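import Literature.NumberTheory.EllipticCurves.CoatesLiTianZhai2015.QuadraticTwistsX049
import Literature.NumberTheory.EllipticCurves.KrizLi2019.ThreeClassNumbers
import Literature.NumberTheory.QuadraticFields.RealQuadraticOddNarrowClassNumber
import Literature.NumberTheory.NumberFields.CMQuadraticExtension
import Mathlib.NumberTheory.LegendreSymbol.JacobiSymbol
import HarnessLib

set_option linter.dupNamespace false
set_option autoImplicit false

/-!
# LINE B49, family F3 — the RANK-ONE PARTNER `49a1^{(−ℓ)}` of the genus pair `(8, −ℓ)` from print BY NAME:
# `h(ℚ(√−ℓ))` odd, «no ideal class of order `4`» discharged, and Coates–Li–Tian–Zhai 2015 Thm. 1.4 at `R₁ = N = 1`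

Cell `bsd-goldfeld`, seat `bsd-goldfeld-s1p-c3` (prover, gen 11); planner g26 ruling (cxiv), act (2). Support for item
`stmt-BirchSwinnertonDyer-19350` (twin `Theses.GoldfeldAllTwistsTwoConverse.BSDTwoCMSplitRankOne`; serves 19140 twin″ /
20044 K12₂″ through LINE B49's third inert prime-twist family F3 = `49a1^{(−2ℓ)}`, `ℓ ≡ 3 (mod 4)` prime, `(ℓ/7) = −1`,
`d_K = −8ℓ`, genus pair `(8, −ℓ)`; scoping memo `HOME/GENUS-THEOREM-A-DOUBLEPRIME-SCOPING.md`). Clean cone (no Theses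
import). HONEST FRAMING: BSD is not proved by any of this; nothing open is asserted; the one printed input is taken BY NAME
(`CoatesLiTianZhai2015.thm14_rankOne_twist`, a `def … : Prop`, nothing asserted) and every theorem using it carries it as an
explicit hypothesis `(h14 : thm14_rankOne_twist)`.

WHAT THIS FILE PROVES.
* §1 (fact-free): for a prime `ℓ ≡ 3 (mod 4)` every quadratic field `F ∋ √−ℓ` has `d_F = −ℓ` (`KrizLi2019.discr_eq_of_sq_eq`)
  and ODD class number (genus theory, tree theorem `Quadratic.odd_classNumber_iff_discr_eq_of_isTotallyComplex`: `h(L)` odd iff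
  `d_L ∈ {−4, −8, −q (q ≡ 3 (4) prime)}`), hence `Cl(F)` has no element of exact order `4`:
  **`noIdealClassOfOrderFour_neg_prime : LiLiuTian2024.NoIdealClassOfOrderFour (−ℓ)`** — the printed side condition of
  Coates–Li–Tian–Zhai 2015 Thm. 1.4 («the ideal class group of `ℚ(√−l₀N)` has no element of exact order `4`») in its case
  `N = 1`, where the paper itself remarks that no hypothesis is needed (arXiv:1312.3884 p0004 L107–L108: «in the special case
  when `k = 0` but `r` is arbitrary, no hypothesis about the ideal class group is needed»).
* §2 (by name): `(−7/ℓ) = (ℓ/7)` for `ℓ ≡ 3 (mod 4)`, and **Theorem 1.4 at `(l₀, R₁, N) = (ℓ, 1, 1)`**: for a prime `ℓ > 3`,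
  `ℓ ≡ 3 (mod 4)`, inert in `ℚ(√−7)`, every globally minimal model `W'` of `A^{(−ℓ)} = 49a1^{(−ℓ)}` has
  `ord_{s=1} L(W', s) = 1`, `rank W'(ℚ) = 1`, `Ш(W')` finite of odd order
  (`rankOne_negPrimeTwist_of_thm14`, `…_of_thm14'` with the family's symbol convention `(ℓ/7) = −1`).
  These are the GOOD twists at `2` (`−ℓ ≡ 1 (mod 4)`: the twisting character is unramified at `2`, where `49a1` is good
  ordinary) — the cell `r1.goodOrd.borel.split` of the S1⁺ partition, i.e. the curves of item 19141 (LTYZ) inside the inert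
  prime family; here only their RANK axis and the odd part of `Ш` are obtained, from CLTZ15 alone.
What is NOT here: the `2`-part of the BSD formula for `49a1^{(−ℓ)}` (not asserted in print: CLTZ15 p0004 L112–L115; it is
item 19141's LTYZ input), and anything about the additive twist `49a1^{(−2ℓ)}` (F3 proper: memo, RESEARCH/ONE-TYPED-FACT).

References: J. Coates, Y. Li, Y. Tian, S. Zhai, *Quadratic twists of elliptic curves*, PLMS 110 (2015) Thm. 1.4 and the remark
after it [CoatesLiTianZhai2015]; A. Fröhlich, M. Taylor, *Algebraic Number Theory* (1991) Ch. V Thm. 39 Cor. 2 [FrohlichTaylor1990];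
D. Cox, *Primes of the form x² + ny²* (2013) Thm. 7.7 [Cox2013]; D. Marcus, *Number Fields* (1977) Ch. 2 [Marcus1977].
-/

noncomputable section

open scoped Classical

open NumberField WeierstrassCurve Literature.NumberTheory.EllipticCurves
  Literature.NumberTheory.EllipticCurves.CoatesLiTianZhai2015

namespace Summit.BirchSwinnertonDyer.BirchSwinnertonDyer.Theorems.GoldfeldGoodTwists

/-! ## §1 `h(ℚ(√−ℓ))` is odd for a prime `ℓ ≡ 3 (mod 4)`; no ideal class of order `4` -/

/-- **`d_F = −ℓ`** for a quadratic field `F ∋ √−ℓ`, `ℓ ≡ 3 (mod 4)` prime: `−ℓ ≡ 1 (mod 4)` is a (squarefree) fundamental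
discriminant and `(√−ℓ)² = −ℓ · 1²` (tree theorem `KrizLi2019.discr_eq_of_sq_eq`). [cite: Marcus1977, Ch. 2 Thm. 1 and Exercise 27(c)] -/
theorem discr_eq_neg_prime_of_sq_eq {F : Type*} [Field F] [NumberField F] (h2 : Module.finrank ℚ F = 2) {l : ℕ}
    (hl : l.Prime) (hl4 : l % 4 = 3) {x : F} (hx : x ^ 2 = -(l : F)) : NumberField.discr F = -(l : ℤ) := by
  have hfund : ((-(l : ℤ)) % 4 = 1 ∧ Squarefree (-(l : ℤ)) ∧ (-(l : ℤ)) ≠ 1) ∨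
      (4 ∣ (-(l : ℤ)) ∧ ((-(l : ℤ)) / 4 % 4 = 2 ∨ (-(l : ℤ)) / 4 % 4 = 3) ∧ Squarefree ((-(l : ℤ)) / 4)) := by
    refine Or.inl ⟨by omega, KrizLi2019.squarefree_neg_natCast hl.squarefree, by omega⟩
  refine KrizLi2019.discr_eq_of_sq_eq h2 (D := -(l : ℤ)) (m := 1) hfund (by ring) ?_ (x := x) ?_
  · have : (0 : ℤ) < l := by exact_mod_cast hl.pos
    omega
  · rw [hx]; push_cast; ring

/-- **`h(F)` is ODD** for a quadratic field `F ∋ √−ℓ`, `ℓ ≡ 3 (mod 4)` prime (genus theory: `d_F = −ℓ` has exactly one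
prime divisor; tree theorem `Quadratic.odd_classNumber_iff_discr_eq_of_isTotallyComplex`; `F` is totally complex as it contains
a square root of `−ℓ < 0`). [cite: FrohlichTaylor1990, Ch. V §1 Thm. 39 Cor. 2, p. 164] -/
theorem odd_classNumber_of_sq_eq_neg_prime {F : Type} [Field F] [NumberField F] (h2 : Module.finrank ℚ F = 2) {l : ℕ}
    (hl : l.Prime) (hl4 : l % 4 = 3) {x : F} (hx : x ^ 2 = -(l : F)) : Odd (NumberField.classNumber F) := by
  haveI : IsTotallyComplex F := Literature.NumberTheory.NumberFields.isTotallyComplex_of_sq_eq_neg_natCast hl.pos hx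
  rw [Literature.NumberTheory.QuadraticFields.Quadratic.odd_classNumber_iff_discr_eq_of_isTotallyComplex h2,
    discr_eq_neg_prime_of_sq_eq h2 hl hl4 hx, neg_neg]
  exact Or.inr (Or.inr ⟨Nat.prime_iff_prime_int.mp hl, by exact_mod_cast hl4⟩)

/-- **«`Cl(ℚ(√−ℓ))` has no element of exact order `4`» for a prime `ℓ ≡ 3 (mod 4)`** — the side condition of
Coates–Li–Tian–Zhai 2015 Thm. 1.4 (tree: `LiLiuTian2024.NoIdealClassOfOrderFour (−l₀N)`) in the case `N = 1`, DISCHARGED: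
the class number is odd, so no element has order `4` (Lagrange; tree `noIdealClassOfOrderFour_of_not_dvd_classNumber`). The paper
notes that in this case no hypothesis is needed (arXiv:1312.3884 p0004 L107–L108).
[cite: CoatesLiTianZhai2015, Thm. 1.4 and the remark after it (p. 360; arXiv p0004 L107–L108)] -/
theorem noIdealClassOfOrderFour_neg_prime {l : ℕ} (hl : l.Prime) (hl4 : l % 4 = 3) :
    LiLiuTian2024.NoIdealClassOfOrderFour (-(l : ℤ)) := by
  refine LiLiuTian2024.noIdealClassOfOrderFour_of_not_dvd_classNumber fun F _ _ h2 hx => ?_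
  obtain ⟨x, hx⟩ := hx
  have hx' : x ^ 2 = -(l : F) := by rw [hx]; push_cast; ring
  intro h4
  have hodd := odd_classNumber_of_sq_eq_neg_prime h2 hl hl4 hx'
  exact (Nat.not_even_iff_odd.mpr hodd) (even_iff_two_dvd.mpr (dvd_trans (by norm_num) h4))

/-! ## §2 Coates–Li–Tian–Zhai 2015 Theorem 1.4 at `R₁ = N = 1`: the good rank-one twists `49a1^{(−ℓ)}` -/

/-- `(−7/ℓ) = (ℓ/7)` for `ℓ ≡ 3 (mod 4)`: `(−7/ℓ) = (−1/ℓ)(7/ℓ) = −(7/ℓ)` and `(7/ℓ) = −(ℓ/7)` (both `≡ 3 (mod 4)`). So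
«`ℓ` inert in `ℚ(√−7)`» reads `(−7/ℓ) = −1` (CLTZ15) or `(ℓ/7) = −1` (the cell's family convention) indifferently. [folklore] -/
theorem jacobiSym_neg_seven_eq_of_three_mod_four {l : ℕ} (hl4 : l % 4 = 3) : jacobiSym (-7) l = jacobiSym l 7 := by
  have hodd : Odd l := Nat.odd_iff.mpr (by omega)
  rw [jacobiSym.neg _ hodd, ZMod.χ₄_nat_three_mod_four hl4]
  have h := jacobiSym.quadratic_reciprocity_three_mod_four (by decide : 7 % 4 = 3) hl4
  rw [show ((7 : ℕ) : ℤ) = 7 from rfl] at h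
  rw [h]
  ring

/-- **Coates–Li–Tian–Zhai 2015 Thm. 1.4 at `(l₀, R₁, N) = (ℓ, 1, 1)`, BY NAME.** For a prime `ℓ > 3`, `ℓ ≡ 3 (mod 4)`,
`(−7/ℓ) = −1` (inert in `ℚ(√−7)`), and any globally minimal model `W'` of `A^{(−ℓ)} = 49a1^{(−ℓ)}`
(`∃ C, C • W' = cm7.quadraticTwist (−ℓ)`): `ord_{s=1} L(W', s) = 1`, `rank W'(ℚ) = 1`, `Ш(W')` finite of odd order. The
hypotheses of the named fact at `R₁ = N = 1` are `InertProduct 1` (tree), two vacuous `∀ q ∣ 1`, `Squarefree 1`, and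
`NoIdealClassOfOrderFour (−ℓ)` (§1, discharged). Conditional on `thm14_rankOne_twist` only.
[cite: CoatesLiTianZhai2015, Thm. 1.4 (p. 360; arXiv p0004 L93–L108), case k = r = 0] -/
theorem rankOne_negPrimeTwist_of_thm14 (h14 : thm14_rankOne_twist) {l : ℕ} (hl : l.Prime) (h3 : 3 < l) (hl4 : l % 4 = 3)
    (hl7 : jacobiSym (-7) l = -1) (W' : WeierstrassCurve ℚ) [W'.IsElliptic] [W'.IsGloballyMinimal]
    (hC : ∃ C : VariableChange ℚ, C • W' = cm7.quadraticTwist (-(l : ℚ))) :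
    W'.analyticRank = 1 ∧ W'.mordellWeilRank = 1 ∧ W'.ShaFinite ∧ Odd W'.shaOrder := by
  have hno : LiLiuTian2024.NoIdealClassOfOrderFour (-((l * 1 : ℕ) : ℤ)) := by
    rw [mul_one]; exact noIdealClassOfOrderFour_neg_prime hl hl4
  have hC' : ∃ C : VariableChange ℚ, C • W' = cm7.quadraticTwist (-((l * 1 * 1 : ℕ) : ℚ)) := by
    rw [mul_one, mul_one]; exact hC
  exact h14 l 1 1 hl h3 hl4 hl7 inertProduct_one (fun q hq hq1 => absurd (Nat.eq_one_of_dvd_one hq1) hq.ne_one)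
    squarefree_one (fun p hp hp1 => absurd (Nat.eq_one_of_dvd_one hp1) hp.ne_one) hno W' hC'

/-- The same with the family convention `(ℓ/7) = −1` of LINE B49 (F3 rows `d = −2ℓ`: the partner `49a1^{(−ℓ)}` is the
rank-one, good-at-`2` member of the genus pair `(8, −ℓ)` of `d_K = −8ℓ`).
[cite: CoatesLiTianZhai2015, Thm. 1.4 (p. 360; arXiv p0004 L93–L108), case k = r = 0] -/
theorem rankOne_negPrimeTwist_of_thm14' (h14 : thm14_rankOne_twist) {l : ℕ} (hl : l.Prime) (h3 : 3 < l) (hl4 : l % 4 = 3)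
    (hl7 : jacobiSym l 7 = -1) (W' : WeierstrassCurve ℚ) [W'.IsElliptic] [W'.IsGloballyMinimal]
    (hC : ∃ C : VariableChange ℚ, C • W' = cm7.quadraticTwist (-(l : ℚ))) :
    W'.analyticRank = 1 ∧ W'.mordellWeilRank = 1 ∧ W'.ShaFinite ∧ Odd W'.shaOrder :=
  rankOne_negPrimeTwist_of_thm14 h14 hl h3 hl4 ((jacobiSym_neg_seven_eq_of_three_mod_four hl4).trans hl7) W' hC

/-- **No `4`-divisibility anywhere on the partner side of F3**: for the SAME primes `ℓ`, the rank-one partner has `#Ш` odd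
(Thm. 1.4) and the partner field `ℚ(√−ℓ)` has odd class number (§1) — the two parity inputs of the memo's mod-`4` device,
recorded together. [cite: CoatesLiTianZhai2015, Thm. 1.4 (p. 360), case k = r = 0] -/
theorem odd_shaOrder_and_odd_classNumber_of_thm14 (h14 : thm14_rankOne_twist) {l : ℕ} (hl : l.Prime) (h3 : 3 < l)
    (hl4 : l % 4 = 3) (hl7 : jacobiSym l 7 = -1) (W' : WeierstrassCurve ℚ) [W'.IsElliptic] [W'.IsGloballyMinimal]
    (hC : ∃ C : VariableChange ℚ, C • W' = cm7.quadraticTwist (-(l : ℚ)))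
    {F : Type} [Field F] [NumberField F] (h2 : Module.finrank ℚ F = 2) {x : F} (hx : x ^ 2 = -(l : F)) :
    Odd W'.shaOrder ∧ Odd (NumberField.classNumber F) :=
  ⟨(rankOne_negPrimeTwist_of_thm14' h14 hl h3 hl4 hl7 W' hC).2.2.2, odd_classNumber_of_sq_eq_neg_prime h2 hl hl4 hx⟩

end Summit.BirchSwinnertonDyer.BirchSwinnertonDyer.Theorems.GoldfeldGoodTwists

end
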